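import Literature.Analysis.InverseSpectral.StieltjesRepresentation
import Literature.Analysis.Complex.HolomorphicParametricIntegral
import HarnessLib

/-!
# Stieltjes transforms are holomorphic off `[0, ∞)`; identity principle on `ℂ ∖ [0, ∞)`

* `differentiableOn_stieltjes` — for Stieltjes data `(b, σ)`, `z ↦ b + ∫ dσ(λ)/(λ - z)` is
  holomorphic on `ℂ ∖ [0, ∞)` (dominated holomorphic parameter integral), hence so is any `q` with
  `HasStieltjesRepresentation q b σ` (`HasStieltjesRepresentation.differentiableOn`);
* `eqOn_offNonnegAxis_of_eqOn_neg` — two functions holomorphic on `ℂ ∖ [0, ∞)` that agree on the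
  negative axis agree everywhere on `ℂ ∖ [0, ∞)` (the domain is star-shaped about `-1`).

These reduce identities between Titchmarsh–Weyl functions to the negative axis, where strings are
governed by positivity (Kac–Kreĭn 1974 §§1–2).

## References

KacKrein1974 (§§1–2, Supplement I).
-/

open MeasureTheory Filter Set Topology Metric
open scoped ENNReal

noncomputable section

namespace Literature.Analysis.InverseSpectral

/-- `ℂ ∖ [0, ∞)` is open (local copy, to keep this file independent of the string files).
[folklore] -/
private theorem isOpen_offNonnegAxis'' : IsOpen offNonnegAxis := by
  have h : offNonnegAxis = {z : ℂ | z.im ≠ 0} ∪ {z : ℂ | z.re < 0} := by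
    ext z; simp [mem_offNonnegAxis]
  rw [h]
  exact (isOpen_ne_fun Complex.continuous_im continuous_const).union
    (isOpen_lt Complex.continuous_re continuous_const)

/-- `ℂ ∖ [0, ∞)` is star-shaped about `-1`. [folklore] -/
theorem starConvex_offNonnegAxis : StarConvex ℝ (-1 : ℂ) offNonnegAxis := by
  intro z hz a b ha hb hab
  have him : (a • (-1 : ℂ) + b • z).im = b * z.im := by simp
  have hre : (a • (-1 : ℂ) + b • z).re = -a + b * z.re := by simp
  show (a • (-1 : ℂ) + b • z) ∈ offNonnegAxis
  rw [mem_offNonnegAxis, him, hre]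
  by_cases hbz : b * z.im = 0
  · right
    rcases hz with hzi | hzr
    · have hb0 : b = 0 := (mul_eq_zero.1 hbz).resolve_right hzi
      have : a = 1 := by linarith
      rw [hb0, this]; norm_num
    · rcases eq_or_lt_of_le hb with hb0 | hb0
      · have : a = 1 := by linarith
        rw [← hb0, this]; norm_num
      · have : b * z.re < 0 := mul_neg_of_pos_of_neg hb0 hzr
        linarith
  · left; exact hbz

/-- `ℂ ∖ [0, ∞)` is preconnected. [folklore] -/
theorem isPreconnected_offNonnegAxis : IsPreconnected offNonnegAxis :=
  (starConvex_offNonnegAxis.isPathConnected (Or.inr (by simp))).isConnected.isPreconnected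

/-- **Identity principle on `ℂ ∖ [0, ∞)`**: holomorphic functions agreeing on the negative axis
agree on all of `ℂ ∖ [0, ∞)`. [folklore] -/
theorem eqOn_offNonnegAxis_of_eqOn_neg {f g : ℂ → ℂ} (hf : DifferentiableOn ℂ f offNonnegAxis)
    (hg : DifferentiableOn ℂ g offNonnegAxis) (h : ∀ s : ℝ, 0 < s → f (-(s : ℂ)) = g (-(s : ℂ))) :
    EqOn f g offNonnegAxis := by
  have hfa := hf.analyticOnNhd isOpen_offNonnegAxis''
  have hga := hg.analyticOnNhd isOpen_offNonnegAxis''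
  have h1 : (-1 : ℂ) ∈ offNonnegAxis := Or.inr (by simp)
  refine hfa.eqOn_of_preconnected_of_mem_closure hga isPreconnected_offNonnegAxis h1 ?_
  rw [mem_closure_iff_seq_limit]
  refine ⟨fun n : ℕ => -(((1 + 1 / ((n : ℝ) + 1) : ℝ)) : ℂ), fun n => ⟨?_, ?_⟩, ?_⟩
  · exact h _ (by positivity)
  · simp only [mem_singleton_iff, neg_inj]
    intro h0
    have h2 : (1 + 1 / ((n : ℝ) + 1) : ℝ) = 1 := by exact_mod_cast h0
    have : (0 : ℝ) < 1 / ((n : ℝ) + 1) := by positivity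
    linarith
  · have hlim : Tendsto (fun n : ℕ => (1 + 1 / ((n : ℝ) + 1) : ℝ)) atTop (𝓝 1) := by
      have h0 := (tendsto_one_div_add_atTop_nhds_zero_nat).const_add (1 : ℝ)
      rw [add_zero] at h0
      exact h0
    have := ((Complex.continuous_ofReal.tendsto 1).comp hlim).neg
    simpa using this

/-! ### Holomorphy of Stieltjes transforms -/

section Holo

variable {q : ℂ → ℂ} {b : ℝ} {σ : Measure ℝ}

/-- **Stieltjes transforms are holomorphic off `[0, ∞)`.** [cite: KacKrein1974, Supplement I] -/
theorem differentiableOn_stieltjes (h : HasStieltjesRepresentation q b σ) :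
    DifferentiableOn ℂ (fun z => (b : ℂ) + ∫ t : ℝ, ((t : ℂ) - z)⁻¹ ∂σ) offNonnegAxis := by
  refine (differentiableOn_const _).add ?_
  have hae : ∀ᵐ t ∂σ, (0 : ℝ) ≤ t := by
    rw [ae_iff]
    have hset : {a : ℝ | ¬0 ≤ a} = Iio 0 := by ext a; simp
    rw [hset]; exact h.2.1
  have hw : Integrable (fun t : ℝ => (1 + t)⁻¹) σ := by
    obtain ⟨-, -, hfin, -⟩ := h
    refine ⟨(measurable_const.add measurable_id).inv.aestronglyMeasurable, ?_⟩
    rw [hasFiniteIntegral_iff_enorm]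
    calc ∫⁻ t, ‖(1 + t)⁻¹‖ₑ ∂σ = ∫⁻ t, ENNReal.ofReal (1 + t)⁻¹ ∂σ := by
          refine lintegral_congr_ae ?_
          filter_upwards [hae] with t ht
          exact Real.enorm_eq_ofReal (by positivity)
      _ < ⊤ := hfin
  refine Literature.Analysis.Complex.differentiableOn_integral_of_dominated
    (fun z _ => (Complex.measurable_ofReal.sub_const z).inv.aestronglyMeasurable) ?_ ?_
  · filter_upwards [hae] with t ht
    intro z hz
    refine ((differentiableAt_const _).sub differentiableAt_id).inv ?_ |>.differentiableWithinAt
    intro h0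
    have hzt : z = (t : ℂ) := (sub_eq_zero.1 h0).symm
    rcases hz with him | hre
    · exact him (by rw [hzt, Complex.ofReal_im])
    · rw [hzt, Complex.ofReal_re] at hre; linarith
  · intro z₀ hz₀
    obtain ⟨D, hD0, hD⟩ := exists_norm_inv_sub_le hz₀
    obtain ⟨R₁, hR₁, hball⟩ := Metric.isOpen_iff.1 isOpen_offNonnegAxis'' z₀ hz₀
    set R := min R₁ (1 / (2 * D + 2)) with hR
    have hRpos : 0 < R := lt_min hR₁ (by positivity)
    refine ⟨R, hRpos, (ball_subset_ball (min_le_left _ _)).trans hball,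
      fun t => (2 * D + 2) * (1 + t)⁻¹, hw.const_mul _, ?_⟩
    filter_upwards [hae] with t ht z hz
    rw [mem_ball, dist_eq_norm] at hz
    -- `‖t - z‖ ≥ ‖t - z₀‖ - R ≥ (1+t)/(D+1) - R ≥ (1+t)/(2D+2)`
    have h1 : (1 + t) / (D + 1) ≤ ‖(t : ℂ) - z₀‖ := by
      have hb := hD t ht
      by_cases h0 : ‖(t : ℂ) - z₀‖ = 0
      · rw [norm_eq_zero, sub_eq_zero] at h0
        exfalso
        rcases hz₀ with him | hre
        · exact him (by rw [← h0, Complex.ofReal_im])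
        · rw [← h0, Complex.ofReal_re] at hre; linarith
      · have hpos : 0 < ‖(t : ℂ) - z₀‖ := lt_of_le_of_ne (norm_nonneg _) (Ne.symm h0)
        rw [norm_inv] at hb
        rw [div_le_iff₀ (by positivity)]
        have := mul_le_mul_of_nonneg_left hb (by positivity : (0 : ℝ) ≤ (1 + t) * ‖(t : ℂ) - z₀‖)
        have h3 : (1 + t) * ‖(t : ℂ) - z₀‖ * ‖(t : ℂ) - z₀‖⁻¹ = 1 + t := by
          field_simp
        rw [h3] at this
        have h4 : (1 + t) * ‖(t : ℂ) - z₀‖ * (D * (1 + t)⁻¹) = D * ‖(t : ℂ) - z₀‖ := by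
          field_simp
        rw [h4] at this
        nlinarith [norm_nonneg ((t : ℂ) - z₀)]
    have h2 : (1 + t) / (2 * D + 2) ≤ ‖(t : ℂ) - z‖ := by
      have h3 := norm_sub_norm_le ((t : ℂ) - z₀) (z - z₀)
      have h4 : (t : ℂ) - z₀ - (z - z₀) = (t : ℂ) - z := by ring
      rw [h4] at h3
      have hR2 : R ≤ 1 / (2 * D + 2) := min_le_right _ _
      have h5 : (1 + t) / (2 * D + 2) ≤ (1 + t) / (D + 1) - 1 / (2 * D + 2) := by
        have e : (1 + t) / (D + 1) - 1 / (2 * D + 2) - (1 + t) / (2 * D + 2) =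
            t / (2 * D + 2) := by
          field_simp
          ring
        have : 0 ≤ t / (2 * D + 2) := by positivity
        linarith
      linarith
    have hpos : 0 < ‖(t : ℂ) - z‖ := lt_of_lt_of_le (by positivity) h2
    rw [norm_inv, inv_eq_one_div, div_le_iff₀ hpos]
    calc (1 : ℝ) = (2 * D + 2) * ((1 + t) / (2 * D + 2)) * (1 + t)⁻¹ := by field_simp
      _ ≤ (2 * D + 2) * ‖(t : ℂ) - z‖ * (1 + t)⁻¹ := by gcongr
      _ = (2 * D + 2) * (1 + t)⁻¹ * ‖(t : ℂ) - z‖ := by ring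

/-- A function with a Stieltjes representation is holomorphic off `[0, ∞)`.
[cite: KacKrein1974, Supplement I] -/
theorem HasStieltjesRepresentation.differentiableOn (h : HasStieltjesRepresentation q b σ) :
    DifferentiableOn ℂ q offNonnegAxis :=
  (differentiableOn_stieltjes h).congr (fun z hz => h.2.2.2 z hz)

/-- **Stieltjes functions are determined by their values on the negative axis.**
[cite: KacKrein1974, Supplement I] -/
theorem eqOn_of_hasStieltjesRepresentation_of_eqOn_neg {q₁ q₂ : ℂ → ℂ} {b₁ b₂ : ℝ}
    {σ₁ σ₂ : Measure ℝ} (h₁ : HasStieltjesRepresentation q₁ b₁ σ₁)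
    (h₂ : HasStieltjesRepresentation q₂ b₂ σ₂)
    (h : ∀ s : ℝ, 0 < s → q₁ (-(s : ℂ)) = q₂ (-(s : ℂ))) :
    EqOn q₁ q₂ offNonnegAxis :=
  eqOn_offNonnegAxis_of_eqOn_neg h₁.differentiableOn h₂.differentiableOn h

end Holo

end Literature.Analysis.InverseSpectral

end
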